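import Mathlib
import Summits.NavierStokesRegularity.NavierStokesRegularity.Theorems.FilamentSkeletonRssKelvinGateFreeResolventC0
import Summits.NavierStokesRegularity.NavierStokesRegularity.Theorems.FilamentSkeletonRssKelvinGateFreeResolventDiv
import Literature.Analysis.FluidPDE.KatoCaloricField

/-!
# Route `FilamentSkeletonRss` · crux `TransverseReduction1A` (stmt-27414; successor of the aside `TransverseReductionRJ`,
# stmt-21221) — line `kelvin_gate`: the free resolvent of WEAKLY divergence-free CONTINUOUS data is divergence free

Helper file (theorems only, `--as helper`).  HONEST FRAMING: analysis bookkeeping for a HYPOTHETICAL filament-type rotating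
self-similar blow-up route; nothing here bears on Navier–Stokes regularity; no stub is proved here.

Item m5 of the design memo SHARP-WEIGHTS-DESIGN-21221-g7.  `…KelvinGateFreeResolventDiv.isDivFree_freeResolvent` needs `F ∈ C¹`
CLASSICALLY divergence free; the projected datum `G = F − ∇Q` of the sharp-scale free gate is only continuous and WEAKLY divergence
free (`∫ ⟨G, ∇θ⟩ = 0` for test functions `θ`, from `ΔQ = div F` in `𝒟′`).  Here:

* `divergence_freeSlice_eq_zero_of_isWeaklyDivFree` — every free slice
  `W_s(y) = (e^{-s/2} R_{−αs}) (e^{(1 − e^{-s})Δ} G)(e^{-s/2} R_{αs} y)` of bounded continuous weakly divergence-free `G` is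
  (classically) divergence free: the caloric extension of weakly solenoidal bounded data is solenoidal
  (`Literature.Analysis.FluidPDE.isDivFree_heatFlow_of_pos`), and the divergence commutes with the rotation–dilation conjugation
  (`divergence_conj`);
* `isDivFree_freeResolvent_of_dominated` — **`div (∫₀^∞ W_s ds) = 0`** under the abstract `DW_s`-domination of
  `…KelvinGateFreeResolventC0` (trace under the integral sign).
-/

set_option linter.dupNamespace false

noncomputable section

namespace Summit.NavierStokesRegularity.NavierStokesRegularity.Theorems.KelvinGate

open Set Function Filter Topology InnerProductSpace MeasureTheory Real Metric
open Literature.Analysis.FluidPDE Literature.Analysis.UnboundedOperators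
open scoped Laplacian RealInnerProductSpace ContDiff Topology ENNReal BigOperators

section Div

variable {F : EuclideanSpace ℝ (Fin 3) → EuclideanSpace ℝ (Fin 3)} {C₀ : ℝ} {α : ℝ} {b₁ : ℝ → ℝ}

/-- The caloric extension of bounded continuous WEAKLY divergence-free data is divergence free (`τ > 0`). -/
theorem isDivFree_heatExtension_of_isWeaklyDivFree (hF : Continuous F) (h0 : ∀ z, ‖F z‖ ≤ C₀)
    (hdiv : IsWeaklyDivFree F) {τ : ℝ} (hτ : 0 < τ) : VectorCalculus.IsDivFree (heatExtension F τ) := by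
  have h := isDivFree_heatFlow_of_pos hdiv (memLp_top_of_continuous_of_bound hF h0) le_top hτ
  rwa [heatFlow_of_pos _ hτ] at h

/-- **Every free slice of bounded continuous weakly divergence-free data is divergence free.** -/
theorem divergence_freeSlice_eq_zero_of_isWeaklyDivFree (hF : Continuous F) (h0 : ∀ z, ‖F z‖ ≤ C₀)
    (hdiv : IsWeaklyDivFree F) (α : ℝ) {s : ℝ} (hs : 0 < s) (y : EuclideanSpace ℝ (Fin 3)) :
    VectorCalculus.divergence (fun z => (Real.exp (-(s / 2)) • rotZL (-(α * s)))
        (heatExtension F (1 - Real.exp (-s)) ((Real.exp (-(s / 2)) • rotZL (α * s)) z))) y = 0 := by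
  rw [divergence_conj, isDivFree_heatExtension_of_isWeaklyDivFree hF h0 hdiv (heatTime_mem_Ioc hs).1 _, mul_zero]

/-- **The free resolvent of weakly divergence-free continuous data is divergence free**: under the abstract domination
`‖DW_s(y)‖ ≤ b₁(s)` (`b₁` integrable on `(0, ∞)`), `div (∫₀^∞ W_s ds) = 0`. -/
theorem isDivFree_freeResolvent_of_dominated (hF : Continuous F) (h0 : ∀ z, ‖F z‖ ≤ C₀)
    (hb₁ : IntegrableOn b₁ (Ioi 0))
    (hD1 : ∀ s, 0 < s → ∀ y, ‖fderiv ℝ (fun z => (Real.exp (-(s / 2)) • rotZL (-(α * s)))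
        (heatExtension F (1 - Real.exp (-s)) ((Real.exp (-(s / 2)) • rotZL (α * s)) z))) y‖ ≤ b₁ s)
    (hdiv : IsWeaklyDivFree F) :
    VectorCalculus.IsDivFree (fun y => ∫ s in Ioi (0:ℝ), (Real.exp (-(s / 2)) • rotZL (-(α * s)))
        (heatExtension F (1 - Real.exp (-s)) ((Real.exp (-(s / 2)) • rotZL (α * s)) y))) := by
  intro y
  rw [divergence_eq_traceCLM, (hasFDerivAt_freeResolvent_of_dominated hF h0 hb₁ hD1 y).fderiv,
    ← (traceCLM : (EuclideanSpace ℝ (Fin 3) →L[ℝ] EuclideanSpace ℝ (Fin 3)) →L[ℝ] ℝ).integral_comp_comm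
      (integrableOn_fderiv_freeSlice_of_dominated hF h0 hb₁ hD1 y)]
  refine setIntegral_eq_zero_of_forall_eq_zero fun s hs => ?_
  rw [← divergence_eq_traceCLM]
  exact divergence_freeSlice_eq_zero_of_isWeaklyDivFree hF h0 hdiv α hs y

end Div

end Summit.NavierStokesRegularity.NavierStokesRegularity.Theorems.KelvinGate

end
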